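import Summits.QuantumFields.GaugeBoot.PlaquetteDeficitTheta
import Summits.QuantumFields.GaugeBoot.EquipartitionWilsonLoops
import HarnessLib

/-!
# Gauge-boot: every rectangular Wilson loop of every `SU(N)` infinite-volume limit state is `1 − O(RT/β_std)` at weak
# coupling (supplement 21, part 3i)

HONEST FRAMING (cell `pub-gaugeboot`, page 1 of every file): certified bounds on lattice
expectations at STATED coupling, gauge group, dimension and torus size; NOT a mass gap, NOT a
continuum limit, NOT a string tension (the bound below says nothing about the large-`R, T` behaviour at fixed
`β`), NOT large `N`; NOT Yang–Mills-summit-bearing (barriers `FixedCouplingUltralocality`, `PerturbativeInvisibility`).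
An analytic weak-coupling statement; it certifies no number.

## Content

ADDENDUM 19 K (`EquipartitionWilsonLoops.rectExpectation_window`): at every infinite-volume limit point `μ` of the `SU(N)`
torus states, `u^{RT} ≤ W_μ(R × T) ≤ u`, `u = W_μ(1 × 1)` the plaquette (reflection positivity / Bachas).  Part 3f
(`SUNRateSharp`): `1 − u ≤ C_N(D)/β_std` with `C_N(D) = 2(16 + (2/D)|a_N + k log 2| + (2/(D−1))|b_N|)`.  Bernoulli's inequality:

* ★★★ `WilsonRate.one_sub_rectExpectation_le` — for `N ≥ 2`, `D ≥ 2`, `β_std ≥ max(2N, C_N(D))`, every limit point `μ` at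
  tree coupling `β_std/N` and every `R, T ≥ 1`:
  **`1 − W_μ(R × T) ≤ R·T·C_N(D)/β_std`** — every rectangular Wilson loop tends to `1` at rate area`/β`, uniformly over
  the limit points; with the lower end `1 − W_μ(R×T) ≥ 1 − u ≥ (N²−1)/(4(D−1)β_std + N²−1)` (`rectExpectation_le_equipartition_std`).

[folklore]
-/

noncomputable section

open MeasureTheory Filter Topology
open Literature.MathematicalPhysics.QuantumFieldTheory
open Literature.MathematicalPhysics.QuantumLattice (LGConfig plaquetteObs infiniteVolumeLimitPoints fundamentalRep rectExpectation
  normalisedCharacter)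

namespace Summit.QuantumFields.GaugeBoot

namespace WilsonRate

/-- The constant `C_N(D) = 2(16 + (2/D)|a_N + k log 2| + (2/(D−1))|b_N|)` of the `SU(N)` deficit bound. -/
def deficitConst (N D : ℕ) : ℝ :=
  2 * (16 + 2 / D * |SUNRateSharp.aSU N + SUNRateSharp.kSU N * Real.log 2| + 2 / ((D : ℝ) - 1) * |SUNRateSharp.bSU N|)

/-- `C_N(D) ≥ 32 > 0` for `D ≥ 2`. -/
theorem deficitConst_pos {N D : ℕ} (hD : 2 ≤ D) : 0 < deficitConst N D := by
  unfold deficitConst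
  have hD' : (0 : ℝ) < (D : ℝ) - 1 := by
    have : (2 : ℝ) ≤ D := by exact_mod_cast hD
    linarith
  positivity

/-- The plaquette of a limit point in the `deficitConst` form: `1 − ∫(1/N)Re tr U_P dμ ≤ C_N(D)/β_std`. -/
theorem one_sub_plaquette_le {N D : ℕ} (hN : 2 ≤ N) (hD : 2 ≤ D) {β : ℝ} (hβ : 2 * (N : ℝ) ≤ β)
    {μ : Measure (LGConfig D (SU N))} (hμ : μ ∈ infiniteVolumeLimitPoints (d := D) (suRep N) (β / N))
    (x : Literature.Probability.LatticeModels.Site D) {i j : Fin D} (hij : i ≠ j) :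
    1 - ∫ U, (N : ℝ)⁻¹ * plaquetteObs (suRep N) x i j U ∂μ ≤ deficitConst N D / β := by
  have h := SUNRateSharp.one_sub_integral_plaquette_le_of_mem_limitPoints hN hD hβ hμ x hij
  refine h.trans (le_of_eq ?_)
  unfold deficitConst
  ring

/-- ★★★ **Rectangular Wilson loops at weak coupling**: for `N ≥ 2`, `D ≥ 2`, `β_std ≥ 2N` with `C_N(D) ≤ β_std`, every
infinite-volume limit point `μ` of the `SU(N)` torus states at tree coupling `β_std/N` and every `R, T ≥ 1`:
`1 − W_μ(R × T) ≤ R·T·C_N(D)/β_std`. [folklore] -/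
theorem one_sub_rectExpectation_le {N D : ℕ} [NeZero D] (hN : 2 ≤ N) (hD : 2 ≤ D) {β : ℝ} (hβ : 2 * (N : ℝ) ≤ β)
    (hβC : deficitConst N D ≤ β)
    {μ : Measure (LGConfig D (Matrix.specialUnitaryGroup (Fin N) ℂ))}
    (hμ : μ ∈ infiniteVolumeLimitPoints (d := D) (fundamentalRep (Fin N)) (β / N)) {R T : ℕ} (hR : 1 ≤ R) (hT : 1 ≤ T) :
    1 - rectExpectation μ (fun g => normalisedCharacter N (fundamentalRep (Fin N) g)) 0 1 R T ≤ R * T * (deficitConst N D / β) := by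
  have hNpos : (0 : ℝ) < N := by exact_mod_cast (show 0 < N by omega)
  have hβ0 : 0 < β := by linarith
  have hβN : 0 < β / N := div_pos hβ0 hNpos
  obtain ⟨hlow, -, -⟩ := EquipartitionZd.rectExpectation_window hN hD hβN hμ hR hT
  set u := rectExpectation μ (fun g => normalisedCharacter N (fundamentalRep (Fin N) g)) 0 1 1 1 with hu
  have h01 : (0 : Fin D) ≠ 1 := by
    intro h
    have := congrArg Fin.val h
    simp at this
    omega
  -- the plaquette deficit
  have hdef : 1 - u ≤ deficitConst N D / β := by
    rw [hu, EquipartitionZd.rectExpectation_one_one_eq]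
    exact one_sub_plaquette_le hN hD hβ hμ 0 h01
  have hC0 := deficitConst_pos (N := N) hD
  have hδ1 : deficitConst N D / β ≤ 1 := by rw [div_le_one hβ0]; exact hβC
  have hu1 : -1 ≤ u := by
    have : 0 ≤ deficitConst N D / β := by positivity
    linarith
  -- Bernoulli: `u^{TR} ≥ 1 + TR (u − 1)`
  have hB := one_add_mul_sub_le_pow hu1 (T * R)
  have hTR : ((T * R : ℕ) : ℝ) = (R : ℝ) * T := by push_cast; ring
  rw [hTR] at hB
  have hRT0 : (0 : ℝ) ≤ (R : ℝ) * T := by positivity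
  calc 1 - rectExpectation μ (fun g => normalisedCharacter N (fundamentalRep (Fin N) g)) 0 1 R T ≤ 1 - u ^ (T * R) := by linarith
    _ ≤ (R : ℝ) * T * (1 - u) := by nlinarith
    _ ≤ R * T * (deficitConst N D / β) := mul_le_mul_of_nonneg_left hdef hRT0

end WilsonRate

end Summit.QuantumFields.GaugeBoot

end
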